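import Summits.QuantumFields.BalabanUV.T4Continuum.Support.ShellMeasureDecayKernelSums
import Summits.QuantumFields.BalabanUV.T4Continuum.Support.ShellMeasureGradientTailHDLocal

/-!
# `T4Continuum.ShellMeasureDecayKernelBinders` — WALL §2 (a) item (P4), row S66 file 3b: «DECAY KERNEL ⇒ ROW∕COLUMN
# SUMS», the NONLINEAR CONVERSION into the owner's file 2b binder shapes.  A map `D` on bond fields with `D 0 = 0`
# whose derivative at every point of a ball is a kernel operator `kerOp (kD A)` (file 3a) with ROW sums `≤ ρ₁‖A‖`
# ((73)-TYPE, prefactor ∝ the radius) satisfies `‖D A‖_∞ ≤ ρ₁‖A‖²_∞` ((55)-TYPE; file 2b's `hMb`∕`hKb` shape), and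
# with COLUMN sums `≤ κ(A)` it satisfies `‖DD(A)(ι_b X)‖₁ ≤ κ(A)‖X‖` (file 2b's `hM'`∕`hK'`∕`hM₃'` shape, `‖·‖₁` = the
# owner's `norm₁`); one more linear decay layer `kerOp h` ((46)∕(3.132)-TYPE) multiplies the constants by its row ∕
# column sum; END-TO-END on the torus `(ℤ∕Tℤ)ᵈ`: decay displays ⇒ file 2b's binders with the EXPLICIT volume-free
# constants `h₀·c₀·(m·K₁ d δ′)·(m·K₁ d δ)` (cell `pub-balaban`, sub-cell `t4`, spine estimate NE7c (node U5b); NE7c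
# ROUND-2 crew, unit `b2b-balaban-t4-ne7c-formalise-leaf-06` gen 4, owner table `LEAVES-NE7c-P1.md` row S66 f3;
# imports file 3a `ShellMeasureDecayKernelSums` and the owner's file 2a `ShellMeasureGradientTailPairing` (p221557,
# for `norm₁`) ONLY; [folklore]; 0 def, 0 `def … : Prop`, 0 sorry)

HONEST FRAMING.  Finite four-torus programme, rung (B)+1 only — NOT infinite volume, NOT a mass gap, NOT the Clay
problem, NOT summit progress; (B), `BetaPertHyp`, (B^μ) are not consumed.  NE7c (`T4IndicatorShell.ShellWeightBound`)
is NOT PRINTED and NOT PROVED; «NE7c ⇐ the named binders».  ELEMENTARY calculus (the mean-value inequality, the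
chain rule) on OUR side; nothing printed is asserted.  [Balaban1985Variational] (cell paper B11) (73) p. 289
*«|𝔇(A′; c, b)| ≤ O(1)C₃ε₃(Lʲη)^{−d+1}e^{−½δ₀d(c₋,y)}»* (and p. 289's remark: for `𝔇₂` *«the bound (73) with ε₃²
instead of ε₃»*), (55) p. 287, (46) (= [5] Thm 3.12, the deep wall) and [5] (3.132) are LOCATORS for the SHAPES of
the hypotheses — DISPLAYED binders of the cell (WALL `t4/b2b-balaban-t4-ne7c-p1/WALL-NE7c-P1.md` §2), not discharged
here; (73) is used in its POINTWISE form (the display at every radius `ε₃ > ‖A′‖`).  HONEST DEPENDENCY (cell):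
continuum YM on T⁴ ⇐ BetaPertH ∧ nine spine estimates (0/9 proved); BetaPertH ⇐ (D1) ∧ (D4) ∧ CAP+tail; G-an2-4 gates
asym, D1 and NE2/3/4.

CONTENT.
* §1 `norm₁_kerOp_le`, `norm₁_kerOp_single_le` — file 3a's column-sum bounds in the owner's `norm₁` currency (`rfl`
  junction: `norm₁ x = Σ_c ‖x c‖`).
* §2 `norm_le_of_norm_fderiv_le_pow` — `D 0 = 0`, `‖DD(A)‖ ≤ ρ₁‖A‖ⁿ` on `ball 0 r` ⟹ `‖D A‖ ≤ ρ₁‖A‖ⁿ⁺¹` (mean value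
  on the closed ball of radius `‖A‖`); `norm_le_of_fderiv_kernel_rowSum` (kernel ROW sums ⟹ the same);
  `norm₁_fderiv_single_le` (kernel COLUMN sums `≤ κ` ⟹ `‖DD(A)(ι_b X)‖₁ ≤ κ‖X‖`); `fderiv_kerOp_comp`,
  `analyticOnNhd_kerOp_comp` (one more linear layer).
* §3 FILE 2b's BINDERS LITERALLY: **`row_binder_of_kernel`** (`∀ A ∈ ball 0 r, ‖D A‖ ≤ ρ₁ * ‖A‖ ^ 2`),
  **`col_binder_of_kernel`** (`∀ A ∈ ball 0 r, ∀ b X, norm₁ (fderiv ℂ D A (Pi.single b X)) ≤ κ A * ‖X‖`, `κ A =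
  m₁‖A‖` or `c₃‖A‖²`), and through a linear decay layer **`row_binder_kerOp_of_kernel`** (`≤ R_H * ρ₁ * ‖A‖ ^ 2`),
  **`col_binder_kerOp_of_kernel`** (`≤ C_H * κ A * ‖X‖`).
* §4 **`binders_of_decay_torus`** — END-TO-END on `(ℤ∕Tℤ)ᵈ` with index placement `pos` (≤ `m` indices per site): a
  (73)-TYPE derivative kernel `‖kD A c b‖ ≤ c₀‖A‖·e^{−δ·pl1(pos c − pos b)}` and a (46)-TYPE layer `‖h e c‖ ≤
  h₀·e^{−δ′·pl1(pos e − pos c)}` give file 2b's `hMb` AND `hM'` for `M = kerOp h ∘ D` with the SAME explicit constant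
  `(h₀·(m·K₁ d δ′))·(c₀·(m·K₁ d δ))` — NO `#Λ`, NO volume (`K₁ d a = Σ_{z ∈ ℤᵈ} e^{−a|z|₁}`,
  `≤ (2∕(1 − e^{−a∕d}))ᵈ` by `NE9KernelGeometryTorus.K₁_le_c0`).
NOT HERE: the four terms of (80) and their `Prop4Hyp` (file 2b, owner); WHICH kernels Bałaban's `H`, `𝔇`, `Δ_π` have
([dict]; (46)∕(73)∕(3.132) stay DISPLAYED); the multi-scale weights (row S65).  No estimate of Bałaban's is discharged;
NOTHING in the countdown moves.
-/

noncomputable section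

open Metric Set

namespace Summit.QuantumFields.BalabanUV.T4Continuum.ShellMeasureDecayKernelBinders

open Literature.MathematicalPhysics.QuantumFieldTheory.Balaban1983to89
open B12Decay510Window (K₁)
open TreeLengthTorus (TPt)
open B12Decay510Torus (pl1)
open B11Prop6Scheme (Prop4Hyp)
open ShellMeasureDecayKernelSums (kerOp kerOp_apply norm_kerOp_le opNorm_kerOp_le sum_norm_kerOp_apply_le_of_col
  sum_norm_kerOp_single_le compKer kerOp_comp_apply rowSum_compKer_le colSum_compKer_le rowSum_le_of_decay_torus
  colSum_le_of_decay_torus)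
open ShellMeasureLocalGradientTail (locGrad)
open ShellMeasureGradientTailPairing (norm₁)
open ShellMeasureGradientTailHDLocal (termsHD prop4Hyp_locGrad_termsHD)

variable {Λ Λ' Λ'' : Type*} {𝔄 𝔅 ℭ : Type*} [NormedAddCommGroup 𝔄] [NormedSpace ℂ 𝔄] [NormedAddCommGroup 𝔅]
  [NormedSpace ℂ 𝔅] [NormedAddCommGroup ℭ] [NormedSpace ℂ ℭ]

/-! ## §1 File 3a's column-sum bounds in the `norm₁` currency -/

/-- `‖kerOp k A‖₁ ≤ C·‖A‖₁` from column sums `≤ C` (`norm₁ x = Σ_c ‖x c‖` by `rfl`). [folklore] -/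
theorem norm₁_kerOp_le [Fintype Λ] [Fintype Λ'] (k : Λ' → Λ → (𝔄 →L[ℂ] 𝔅)) {C : ℝ}
    (hcol : ∀ b, ∑ c, ‖k c b‖ ≤ C) (A : Λ → 𝔄) : norm₁ (kerOp k A) ≤ C * norm₁ A :=
  sum_norm_kerOp_apply_le_of_col k hcol A

/-- `‖kerOp k (ι_b X)‖₁ ≤ (Σ_c ‖k c b‖)·‖X‖` — a single-bond direction costs ONE column. [folklore] -/
theorem norm₁_kerOp_single_le [Fintype Λ] [Fintype Λ'] [DecidableEq Λ] (k : Λ' → Λ → (𝔄 →L[ℂ] 𝔅)) (b : Λ)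
    (X : 𝔄) : norm₁ (kerOp k (Pi.single b X)) ≤ (∑ c, ‖k c b‖) * ‖X‖ :=
  sum_norm_kerOp_single_le k b X

/-! ## §2 The nonlinear conversion: (73)-TYPE derivative kernels ⇒ (55)-TYPE bounds -/

/-- **MEAN VALUE, POWER PREFACTOR**: `D` differentiable on `ball 0 r` with `D 0 = 0` and `‖DD(A)‖ ≤ ρ₁‖A‖ⁿ` there ⟹
`‖D A‖ ≤ ρ₁‖A‖ⁿ⁺¹` on the ball (mean value on the closed ball of radius `‖A‖`, where `‖DD‖ ≤ ρ₁‖A‖ⁿ`).  `n = 1`: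
(73)-TYPE (prefactor `∝ ε₃`) ⇒ (55)-TYPE (`‖D(A′)‖ ≤ const·‖A′‖²`); `n = 2`: p. 289's remark on `𝔇₂` (prefactor `ε₃²`).
[folklore] -/
theorem norm_le_of_norm_fderiv_le_pow {E F : Type*} [NormedAddCommGroup E] [NormedSpace ℂ E] [NormedAddCommGroup F]
    [NormedSpace ℂ F] {D : E → F} {r ρ₁ : ℝ} {n : ℕ} (hρ₁ : 0 ≤ ρ₁) (hD : DifferentiableOn ℂ D (ball 0 r))
    (hD0 : D 0 = 0) (hder : ∀ A ∈ ball (0 : E) r, ‖fderiv ℂ D A‖ ≤ ρ₁ * ‖A‖ ^ n) {A : E}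
    (hA : A ∈ ball (0 : E) r) : ‖D A‖ ≤ ρ₁ * ‖A‖ ^ (n + 1) := by
  have hAr : ‖A‖ < r := mem_ball_zero_iff.1 hA
  have hsub : closedBall (0 : E) ‖A‖ ⊆ ball 0 r := closedBall_subset_ball hAr
  have hdiff : ∀ y ∈ closedBall (0 : E) ‖A‖, DifferentiableAt ℂ D y := fun y hy =>
    hD.differentiableAt (isOpen_ball.mem_nhds (hsub hy))
  have hbound : ∀ y ∈ closedBall (0 : E) ‖A‖, ‖fderiv ℂ D y‖ ≤ ρ₁ * ‖A‖ ^ n := fun y hy => by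
    have hy' : ‖y‖ ≤ ‖A‖ := mem_closedBall_zero_iff.1 hy
    exact (hder y (hsub hy)).trans (mul_le_mul_of_nonneg_left (pow_le_pow_left₀ (norm_nonneg y) hy' n) hρ₁)
  have h := (convex_closedBall (0 : E) ‖A‖).norm_image_sub_le_of_norm_fderiv_le hdiff hbound
    (mem_closedBall_self (norm_nonneg A)) (mem_closedBall_zero_iff.2 le_rfl)
  rw [hD0, sub_zero, sub_zero] at h
  calc ‖D A‖ ≤ ρ₁ * ‖A‖ ^ n * ‖A‖ := h
    _ = ρ₁ * ‖A‖ ^ (n + 1) := by ring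

/-- **(73)-TYPE KERNEL ROW SUMS ⇒ (55)-TYPE BOUND**: `D : (Λ → 𝔄) → (Λ′ → 𝔅)` differentiable on `ball 0 r`, `D 0 = 0`,
`DD(A) = kerOp (kD A)` with row sums `Σ_b ‖kD A c b‖ ≤ ρ₁‖A‖ⁿ` on the ball ⟹ `‖D A‖_∞ ≤ ρ₁‖A‖_∞ⁿ⁺¹`. [folklore] -/
theorem norm_le_of_fderiv_kernel_rowSum [Fintype Λ] [Fintype Λ'] {D : (Λ → 𝔄) → (Λ' → 𝔅)} {r ρ₁ : ℝ} {n : ℕ}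
    (hρ₁ : 0 ≤ ρ₁) (hD : DifferentiableOn ℂ D (ball 0 r)) (hD0 : D 0 = 0)
    (kD : (Λ → 𝔄) → Λ' → Λ → (𝔄 →L[ℂ] 𝔅)) (hker : ∀ A ∈ ball (0 : Λ → 𝔄) r, fderiv ℂ D A = kerOp (kD A))
    (hrow : ∀ A ∈ ball (0 : Λ → 𝔄) r, ∀ c, ∑ b, ‖kD A c b‖ ≤ ρ₁ * ‖A‖ ^ n)
    {A : Λ → 𝔄} (hA : A ∈ ball (0 : Λ → 𝔄) r) : ‖D A‖ ≤ ρ₁ * ‖A‖ ^ (n + 1) :=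
  norm_le_of_norm_fderiv_le_pow hρ₁ hD hD0 (fun A' hA' => by
    rw [hker A' hA']
    exact opNorm_kerOp_le (kD A') (by positivity) (hrow A' hA')) hA

/-- **KERNEL COLUMN SUMS ⇒ THE SINGLE-BOND ℓ¹ BINDER**: `DD(A) = kerOp kD` with column sums `Σ_c ‖kD c b‖ ≤ κ` ⟹
`‖DD(A)(ι_b X)‖₁ ≤ κ·‖X‖` (`κ = m₁‖A‖`, `c₃‖A‖²`, … as displayed). [folklore] -/
theorem norm₁_fderiv_single_le [Fintype Λ] [Fintype Λ'] [DecidableEq Λ] {D : (Λ → 𝔄) → (Λ' → 𝔅)}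
    {A : Λ → 𝔄} (kD : Λ' → Λ → (𝔄 →L[ℂ] 𝔅)) (hker : fderiv ℂ D A = kerOp kD) {κ : ℝ} (b : Λ)
    (hcol : ∑ c, ‖kD c b‖ ≤ κ) (X : 𝔄) : norm₁ (fderiv ℂ D A (Pi.single b X)) ≤ κ * ‖X‖ := by
  rw [hker]
  exact (sum_norm_kerOp_single_le kD b X).trans (mul_le_mul_of_nonneg_right hcol (norm_nonneg X))

omit [NormedSpace ℂ 𝔄] in
/-- **ONE MORE LINEAR DECAY LAYER, sup side** (the `hMb` SHAPE of file 2b for `H ∘ D`): row sums of `h` `≤ R_H` and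
`‖D A‖_∞ ≤ ρ₁‖A‖ⁿ⁺¹` ⟹ `‖kerOp h (D A)‖_∞ ≤ R_H·ρ₁·‖A‖ⁿ⁺¹`. [folklore] -/
theorem norm_kerOp_map_le [Fintype Λ] [Fintype Λ'] [Fintype Λ''] (h : Λ'' → Λ' → (𝔅 →L[ℂ] ℭ)) {R_H : ℝ}
    (hR : 0 ≤ R_H) (hrow : ∀ e, ∑ c, ‖h e c‖ ≤ R_H) {D : (Λ → 𝔄) → (Λ' → 𝔅)} {ρ₁ : ℝ} {n : ℕ} {A : Λ → 𝔄}
    (hDA : ‖D A‖ ≤ ρ₁ * ‖A‖ ^ (n + 1)) : ‖kerOp h (D A)‖ ≤ R_H * ρ₁ * ‖A‖ ^ (n + 1) :=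
  (norm_kerOp_le h hR hrow (D A)).trans (by rw [mul_assoc]; exact mul_le_mul_of_nonneg_left hDA hR)

/-- Chain rule through a linear kernel layer: `D(kerOp h ∘ D)(A) = kerOp h ∘ DD(A)`. [folklore] -/
theorem fderiv_kerOp_comp [Fintype Λ] [Fintype Λ'] [Fintype Λ''] (h : Λ'' → Λ' → (𝔅 →L[ℂ] ℭ)) {D : (Λ → 𝔄) → (Λ' → 𝔅)}
    {A : Λ → 𝔄} (hD : DifferentiableAt ℂ D A) :
    fderiv ℂ (fun A => kerOp h (D A)) A = (kerOp h).comp (fderiv ℂ D A) := by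
  rw [show (fun A => kerOp h (D A)) = (kerOp h) ∘ D from rfl, fderiv_comp A (kerOp h).differentiableAt hD,
    ContinuousLinearMap.fderiv]

/-- `A ↦ kerOp h (D A)` is analytic where `D` is (one more LINEAR layer; file 2b's `hMa`∕`hKa`). [folklore] -/
theorem analyticOnNhd_kerOp_comp [Fintype Λ'] [Fintype Λ''] {E : Type*} [NormedAddCommGroup E] [NormedSpace ℂ E]
    (h : Λ'' → Λ' → (𝔅 →L[ℂ] ℭ)) {D : E → (Λ' → 𝔅)} {s : Set E} (hD : AnalyticOnNhd ℂ D s) :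
    AnalyticOnNhd ℂ (fun A => kerOp h (D A)) s := fun x hx => ((kerOp h).analyticAt _).comp (hD x hx)

/-- … and differentiable where `D` is. [folklore] -/
theorem differentiableOn_kerOp_comp [Fintype Λ'] [Fintype Λ''] {E : Type*} [NormedAddCommGroup E]
    [NormedSpace ℂ E] (h : Λ'' → Λ' → (𝔅 →L[ℂ] ℭ)) {D : E → (Λ' → 𝔅)} {s : Set E}
    (hD : DifferentiableOn ℂ D s) : DifferentiableOn ℂ (fun A => kerOp h (D A)) s :=
  (kerOp h).differentiable.comp_differentiableOn hD

/-- **ONE MORE LINEAR DECAY LAYER, ℓ¹ side** (the `hM'` SHAPE of file 2b for `H ∘ D`): column sums of `h` `≤ C_H`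
(`C_H ≥ 0`) and `‖DD(A)(ι_b X)‖₁ ≤ κ‖X‖` ⟹ `‖D(kerOp h ∘ D)(A)(ι_b X)‖₁ ≤ C_H·κ·‖X‖`. [folklore] -/
theorem norm₁_kerOp_fderiv_single_le [Fintype Λ] [Fintype Λ'] [Fintype Λ''] [DecidableEq Λ]
    (h : Λ'' → Λ' → (𝔅 →L[ℂ] ℭ)) {C_H : ℝ} (hC : 0 ≤ C_H) (hcol : ∀ c, ∑ e, ‖h e c‖ ≤ C_H)
    {D : (Λ → 𝔄) → (Λ' → 𝔅)} {A : Λ → 𝔄} (hD : DifferentiableAt ℂ D A) {κ : ℝ} {b : Λ} {X : 𝔄}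
    (hDX : norm₁ (fderiv ℂ D A (Pi.single b X)) ≤ κ * ‖X‖) :
    norm₁ (fderiv ℂ (fun A => kerOp h (D A)) A (Pi.single b X)) ≤ C_H * κ * ‖X‖ := by
  rw [fderiv_kerOp_comp h hD, ContinuousLinearMap.comp_apply]
  refine (norm₁_kerOp_le h hcol _).trans ?_
  rw [mul_assoc]
  exact mul_le_mul_of_nonneg_left hDX hC


/-! ## §3 File 2b's binders LITERALLY (`norm_locGrad_termsHD_le`'s `hMb`∕`hKb`, `hM'`∕`hK'`∕`hM₃'`) -/

/-- **ROW-SUM TYPE BINDER** (`hMb`∕`hKb` shape): (73)-TYPE row sums `Σ_b ‖kD A c b‖ ≤ ρ₁‖A‖` on the ball, `D 0 = 0` ⟹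
`∀ A ∈ ball 0 r, ‖D A‖ ≤ ρ₁ * ‖A‖ ^ 2`. [folklore] -/
theorem row_binder_of_kernel [Fintype Λ] [Fintype Λ'] {D : (Λ → 𝔄) → (Λ' → 𝔅)} {r ρ₁ : ℝ} (hρ₁ : 0 ≤ ρ₁)
    (hD : DifferentiableOn ℂ D (ball 0 r)) (hD0 : D 0 = 0) (kD : (Λ → 𝔄) → Λ' → Λ → (𝔄 →L[ℂ] 𝔅))
    (hker : ∀ A ∈ ball (0 : Λ → 𝔄) r, fderiv ℂ D A = kerOp (kD A))
    (hrow : ∀ A ∈ ball (0 : Λ → 𝔄) r, ∀ c, ∑ b, ‖kD A c b‖ ≤ ρ₁ * ‖A‖) :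
    ∀ A ∈ ball (0 : Λ → 𝔄) r, ‖D A‖ ≤ ρ₁ * ‖A‖ ^ 2 := fun A hA => by
  have h := norm_le_of_fderiv_kernel_rowSum (n := 1) hρ₁ hD hD0 kD hker
    (fun A' hA' c => by rw [pow_one]; exact hrow A' hA' c) hA
  simpa using h

/-- … through one more linear decay layer with row sums `≤ R_H`: `∀ A ∈ ball 0 r, ‖kerOp h (D A)‖ ≤ R_H * ρ₁ * ‖A‖ ^ 2`
(file 2b's `hMb` for `M = H ∘ D`, `m_∞ = R_H·ρ₁`; iterate for `K = Δ_π ∘ H ∘ D`). [folklore] -/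
theorem row_binder_kerOp_of_kernel [Fintype Λ] [Fintype Λ'] [Fintype Λ''] {D : (Λ → 𝔄) → (Λ' → 𝔅)} {r ρ₁ : ℝ}
    (hρ₁ : 0 ≤ ρ₁) (hD : DifferentiableOn ℂ D (ball 0 r)) (hD0 : D 0 = 0)
    (kD : (Λ → 𝔄) → Λ' → Λ → (𝔄 →L[ℂ] 𝔅)) (hker : ∀ A ∈ ball (0 : Λ → 𝔄) r, fderiv ℂ D A = kerOp (kD A))
    (hrow : ∀ A ∈ ball (0 : Λ → 𝔄) r, ∀ c, ∑ b, ‖kD A c b‖ ≤ ρ₁ * ‖A‖) (h : Λ'' → Λ' → (𝔅 →L[ℂ] ℭ)) {R_H : ℝ}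
    (hR : 0 ≤ R_H) (hhrow : ∀ e, ∑ c, ‖h e c‖ ≤ R_H) :
    ∀ A ∈ ball (0 : Λ → 𝔄) r, ‖kerOp h (D A)‖ ≤ R_H * ρ₁ * ‖A‖ ^ 2 := fun A hA =>
  (norm_kerOp_le h hR hhrow (D A)).trans (by
    rw [mul_assoc]
    exact mul_le_mul_of_nonneg_left (row_binder_of_kernel hρ₁ hD hD0 kD hker hrow A hA) hR)

/-- **COLUMN-SUM TYPE BINDER** (`hM'`∕`hK'`∕`hM₃'` shape): kernel column sums `Σ_c ‖kD A c b‖ ≤ κ A` on the ball ⟹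
`∀ A ∈ ball 0 r, ∀ b X, norm₁ (fderiv ℂ D A (Pi.single b X)) ≤ κ A * ‖X‖` (`κ A = m₁ * ‖A‖` gives `hM'`∕`hK'`,
`κ A = c₃ * ‖A‖ ^ 2` gives `hM₃'`, by `rfl`∕beta). [folklore] -/
theorem col_binder_of_kernel [Fintype Λ] [Fintype Λ'] [DecidableEq Λ] {D : (Λ → 𝔄) → (Λ' → 𝔅)} {r : ℝ}
    (kD : (Λ → 𝔄) → Λ' → Λ → (𝔄 →L[ℂ] 𝔅)) (hker : ∀ A ∈ ball (0 : Λ → 𝔄) r, fderiv ℂ D A = kerOp (kD A))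
    (κ : (Λ → 𝔄) → ℝ) (hcol : ∀ A ∈ ball (0 : Λ → 𝔄) r, ∀ b, ∑ c, ‖kD A c b‖ ≤ κ A) :
    ∀ A ∈ ball (0 : Λ → 𝔄) r, ∀ (b : Λ) (X : 𝔄), norm₁ (fderiv ℂ D A (Pi.single b X)) ≤ κ A * ‖X‖ :=
  fun A hA b X => norm₁_fderiv_single_le (kD A) (hker A hA) b (hcol A hA b) X

/-- … through one more linear decay layer with column sums `≤ C_H`:
`∀ A ∈ ball 0 r, ∀ b X, norm₁ (fderiv ℂ (kerOp h ∘ D) A (Pi.single b X)) ≤ C_H * κ A * ‖X‖` (file 2b's `hM'` for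
`M = H ∘ D` with `m₁‖A‖ = C_H·κ A`). [folklore] -/
theorem col_binder_kerOp_of_kernel [Fintype Λ] [Fintype Λ'] [Fintype Λ''] [DecidableEq Λ]
    {D : (Λ → 𝔄) → (Λ' → 𝔅)} {r : ℝ} (hD : DifferentiableOn ℂ D (ball 0 r))
    (kD : (Λ → 𝔄) → Λ' → Λ → (𝔄 →L[ℂ] 𝔅)) (hker : ∀ A ∈ ball (0 : Λ → 𝔄) r, fderiv ℂ D A = kerOp (kD A))
    (κ : (Λ → 𝔄) → ℝ) (hcol : ∀ A ∈ ball (0 : Λ → 𝔄) r, ∀ b, ∑ c, ‖kD A c b‖ ≤ κ A)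
    (h : Λ'' → Λ' → (𝔅 →L[ℂ] ℭ)) {C_H : ℝ} (hC : 0 ≤ C_H) (hhcol : ∀ c, ∑ e, ‖h e c‖ ≤ C_H) :
    ∀ A ∈ ball (0 : Λ → 𝔄) r, ∀ (b : Λ) (X : 𝔄),
      norm₁ (fderiv ℂ (fun A => kerOp h (D A)) A (Pi.single b X)) ≤ C_H * κ A * ‖X‖ :=
  fun A hA b X => norm₁_kerOp_fderiv_single_le h hC hhcol (hD.differentiableAt (isOpen_ball.mem_nhds hA))
    (col_binder_of_kernel kD hker κ hcol A hA b X)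

/-! ## §4 End-to-end on the torus: decay displays ⇒ file 2b's binders with explicit volume-free constants -/

/-- **DECAY DISPLAYS ⇒ FILE 2b's BINDERS, ON THE TORUS, VOLUME-FREE.**  Index placement `pos : Λ → (ℤ∕Tℤ)ᵈ` with at
most `m` indices per site; `D` differentiable on `ball 0 r`, `D 0 = 0`, with a (73)-TYPE derivative kernel
`‖kD A c b‖ ≤ c₀‖A‖·e^{−δ·pl1(pos c − pos b)}` (`δ > 0`); a (46)∕(3.132)-TYPE linear layer `‖h e c‖ ≤
h₀·e^{−δ′·pl1(pos e − pos c)}` (`δ′ > 0`).  Then `M := kerOp h ∘ D` satisfies file 2b's `hMb` AND `hM'` with the SAME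
EXPLICIT constant `m₀ = m₁ = (h₀·(m·K₁ d δ′))·(c₀·(m·K₁ d δ))` — no `#Λ`, no `T`. [folklore] -/
theorem binders_of_decay_torus [Fintype Λ] [DecidableEq Λ] {d T : ℕ} [NeZero T] (pos : Λ → TPt d T) {m : ℕ}
    (hm : ∀ x, (Finset.univ.filter fun b => pos b = x).card ≤ m) {D : (Λ → 𝔄) → (Λ → 𝔄)} {r c₀ δ : ℝ}
    (hc₀ : 0 ≤ c₀) (hδ : 0 < δ) (hD : DifferentiableOn ℂ D (ball 0 r)) (hD0 : D 0 = 0)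
    (kD : (Λ → 𝔄) → Λ → Λ → (𝔄 →L[ℂ] 𝔄)) (hker : ∀ A ∈ ball (0 : Λ → 𝔄) r, fderiv ℂ D A = kerOp (kD A))
    (hkD : ∀ A ∈ ball (0 : Λ → 𝔄) r, ∀ c b, ‖kD A c b‖ ≤ c₀ * ‖A‖ * Real.exp (-(δ * pl1 (pos c - pos b))))
    (h : Λ → Λ → (𝔄 →L[ℂ] 𝔄)) {h₀ δ' : ℝ} (hh₀ : 0 ≤ h₀) (hδ' : 0 < δ')
    (hh : ∀ e c, ‖h e c‖ ≤ h₀ * Real.exp (-(δ' * pl1 (pos e - pos c)))) :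
    (∀ A ∈ ball (0 : Λ → 𝔄) r, ‖kerOp h (D A)‖ ≤ h₀ * (m * K₁ d δ') * (c₀ * (m * K₁ d δ)) * ‖A‖ ^ 2) ∧
    (∀ A ∈ ball (0 : Λ → 𝔄) r, ∀ (b : Λ) (X : 𝔄),
      norm₁ (fderiv ℂ (fun A => kerOp h (D A)) A (Pi.single b X)) ≤
        h₀ * (m * K₁ d δ') * (c₀ * (m * K₁ d δ) * ‖A‖) * ‖X‖) := by
  have hK : 0 ≤ (m : ℝ) * K₁ d δ := mul_nonneg (Nat.cast_nonneg m) (B12Decay510Window.K₁_nonneg d δ)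
  have hK' : 0 ≤ (m : ℝ) * K₁ d δ' := mul_nonneg (Nat.cast_nonneg m) (B12Decay510Window.K₁_nonneg d δ')
  -- the (73)-type kernel: row AND column sums `≤ (c₀‖A‖)·(m·K₁ d δ)` at every point of the ball
  have hrow : ∀ A ∈ ball (0 : Λ → 𝔄) r, ∀ c, ∑ b, ‖kD A c b‖ ≤ c₀ * (m * K₁ d δ) * ‖A‖ := fun A hA c => by
    have h1 := rowSum_le_of_decay_torus (kD A) pos pos (mul_nonneg hc₀ (norm_nonneg A)) hδ hm (hkD A hA) c
    calc ∑ b, ‖kD A c b‖ ≤ c₀ * ‖A‖ * (m * K₁ d δ) := h1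
      _ = c₀ * (m * K₁ d δ) * ‖A‖ := by ring
  have hcol : ∀ A ∈ ball (0 : Λ → 𝔄) r, ∀ b, ∑ c, ‖kD A c b‖ ≤ c₀ * (m * K₁ d δ) * ‖A‖ := fun A hA b => by
    have h1 := colSum_le_of_decay_torus (kD A) pos pos (mul_nonneg hc₀ (norm_nonneg A)) hδ hm (hkD A hA) b
    calc ∑ c, ‖kD A c b‖ ≤ c₀ * ‖A‖ * (m * K₁ d δ) := h1
      _ = c₀ * (m * K₁ d δ) * ‖A‖ := by ring
  -- the (46)-type layer: row and column sums `≤ h₀·(m·K₁ d δ′)`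
  have hhrow : ∀ e, ∑ c, ‖h e c‖ ≤ h₀ * (m * K₁ d δ') := rowSum_le_of_decay_torus h pos pos hh₀ hδ' hm hh
  have hhcol : ∀ c, ∑ e, ‖h e c‖ ≤ h₀ * (m * K₁ d δ') := colSum_le_of_decay_torus h pos pos hh₀ hδ' hm hh
  refine ⟨row_binder_kerOp_of_kernel (by positivity) hD hD0 kD hker hrow h (by positivity) hhrow, ?_⟩
  exact col_binder_kerOp_of_kernel hD kD hker (fun A => c₀ * (m * K₁ d δ) * ‖A‖) hcol h (by positivity) hhcol

/-! ## §5 Capstone: decay displays on the torus ⇒ file 2b's `Prop4Hyp` for (80)'s HD-terms -/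

/-- **DECAY DISPLAYS ⇒ THE (98) SHAPE OF (80)'s HD-TERMS, PER BOND, VOLUME-FREE, EXPLICIT** (file 2b's
`prop4Hyp_locGrad_termsHD` with ALL FIVE decay binders `hMb`∕`hKb`∕`hM'`∕`hK'`∕`hM₃'` and the three analyticity clauses
DISCHARGED from kernel data on the torus `(ℤ∕Tℤ)ᵈ`).  Data: a placement `pos` (≤ `m` indices per site); the Landau
correction `D` and its order-≥3 part `D₃`, analytic on `ball 0 r`, `D 0 = 0`, with (73)-TYPE derivative kernels
`‖kD A c b‖ ≤ c₀‖A‖e^{−δ·pl1}`, `‖kD₃ A c b‖ ≤ c₃‖A‖²e^{−δ·pl1}` (p. 289's remark); the layers `H` ((46)-TYPE,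
`‖hH e c‖ ≤ h₀e^{−δ_H·pl1}`) and `Δ_π` ((3.132)-TYPE, `‖hP e c‖ ≤ p₀e^{−δ_P·pl1}`) as decaying kernels;
constants `Hc ≥ h₀·m·K₁ d δ_H`, `Pc ≥ p₀·m·K₁ d δ_P`, `Dc ≥ c₀·m·K₁ d δ`, `D₃c ≥ c₃·m·K₁ d δ` (the volume-free sums of
file 3a) and the smallness `Hc·Dc·r ≤ 1`.  Then for `M = H∘D`, `M₃ = H∘D₃`, `K = (Δ_π∘H)∘D` (kernel `compKer hP hH`):
`Prop4Hyp (locGrad (termsHD π J M M₃ K V₀)) C r` with `C` = file 2b's polynomial at `m₀ = m₁ = Hc·Dc`,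
`k₀ = k₁ = Pc·Hc·Dc`, `c₃ = Hc·D₃c` — i.e. `C = ‖π‖·(j₀·Hc·D₃c + 2·Pc·Hc·Dc + Pc·Hc²·Dc²) + 4C₀(1 + Hc·Dc)`, written
below in the un-simplified substituted form.  Still DISPLAYED: `J`'s bound `j₀`, the plaquette part's `C₀` (S62's
shape), and WHICH kernels Bałaban's `H`, `𝔇`, `Δ_π` have ([dict]). [folklore] -/
theorem prop4Hyp_termsHD_of_decay_torus [Fintype Λ] [DecidableEq Λ] {d T : ℕ} [NeZero T] (pos : Λ → TPt d T)
    {m : ℕ} (hm : ∀ x, (Finset.univ.filter fun b => pos b = x).card ≤ m) (π : 𝔄 →L[ℂ] 𝔄 →L[ℂ] ℂ) (J : Λ → 𝔄)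
    (V₀ : (Λ → 𝔄) → ℂ) {D D₃ : (Λ → 𝔄) → (Λ → 𝔄)} {r R₀ C₀ j₀ c₀ c₃ δ h₀ δH p₀ δP Hc Pc Dc D₃c : ℝ}
    (hr : 0 < r) (hr1 : r ≤ 1) (hrR₀ : 2 * r ≤ R₀) (hC₀ : 0 ≤ C₀) (hJ : ‖J‖ ≤ j₀) (hc₀ : 0 ≤ c₀) (hc₃ : 0 ≤ c₃)
    (hδ : 0 < δ) (hh₀ : 0 ≤ h₀) (hδH : 0 < δH) (hp₀ : 0 ≤ p₀) (hδP : 0 < δP)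
    (hDa : AnalyticOnNhd ℂ D (ball 0 r)) (hD0 : D 0 = 0) (kD : (Λ → 𝔄) → Λ → Λ → (𝔄 →L[ℂ] 𝔄))
    (hker : ∀ A ∈ ball (0 : Λ → 𝔄) r, fderiv ℂ D A = kerOp (kD A))
    (hkD : ∀ A ∈ ball (0 : Λ → 𝔄) r, ∀ c b, ‖kD A c b‖ ≤ c₀ * ‖A‖ * Real.exp (-(δ * pl1 (pos c - pos b))))
    (hD₃a : AnalyticOnNhd ℂ D₃ (ball 0 r)) (kD₃ : (Λ → 𝔄) → Λ → Λ → (𝔄 →L[ℂ] 𝔄))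
    (hker₃ : ∀ A ∈ ball (0 : Λ → 𝔄) r, fderiv ℂ D₃ A = kerOp (kD₃ A))
    (hkD₃ : ∀ A ∈ ball (0 : Λ → 𝔄) r, ∀ c b, ‖kD₃ A c b‖ ≤ c₃ * ‖A‖ ^ 2 * Real.exp (-(δ * pl1 (pos c - pos b))))
    (hH : Λ → Λ → (𝔄 →L[ℂ] 𝔄)) (hhH : ∀ e c, ‖hH e c‖ ≤ h₀ * Real.exp (-(δH * pl1 (pos e - pos c))))
    (hP : Λ → Λ → (𝔄 →L[ℂ] 𝔄)) (hhP : ∀ e c, ‖hP e c‖ ≤ p₀ * Real.exp (-(δP * pl1 (pos e - pos c))))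
    (hV₀a : AnalyticOnNhd ℂ V₀ (ball 0 R₀)) (hV₀g : ∀ y ∈ ball (0 : Λ → 𝔄) R₀, ‖locGrad V₀ y‖ ≤ C₀ * ‖y‖ ^ 2)
    (hHc : h₀ * (m * K₁ d δH) ≤ Hc) (hPc : p₀ * (m * K₁ d δP) ≤ Pc) (hDc : c₀ * (m * K₁ d δ) ≤ Dc)
    (hD₃c : c₃ * (m * K₁ d δ) ≤ D₃c) (hsmall : Hc * Dc * r ≤ 1) :
    Prop4Hyp (locGrad (termsHD π J (fun A => kerOp hH (D A)) (fun A => kerOp hH (D₃ A))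
        (fun A => kerOp (compKer hP hH) (D A)) V₀))
      (‖π‖ * (j₀ * (Hc * D₃c) + Pc * Hc * Dc + Pc * Hc * Dc + (Hc * Dc * (Pc * Hc * Dc) + Hc * Dc * (Pc * Hc * Dc)) / 2)
        + 4 * C₀ * (1 + Hc * Dc)) r := by
  have hK₁ : ∀ a : ℝ, 0 ≤ (m : ℝ) * K₁ d a := fun a => mul_nonneg (Nat.cast_nonneg m) (B12Decay510Window.K₁_nonneg d a)
  have hHc0 : 0 ≤ Hc := (mul_nonneg hh₀ (hK₁ δH)).trans hHc
  have hPc0 : 0 ≤ Pc := (mul_nonneg hp₀ (hK₁ δP)).trans hPc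
  have hDc0 : 0 ≤ Dc := (mul_nonneg hc₀ (hK₁ δ)).trans hDc
  have hD₃c0 : 0 ≤ D₃c := (mul_nonneg hc₃ (hK₁ δ)).trans hD₃c
  -- the volume-free sums (file 3a), each relaxed to the named constant
  have hDrow : ∀ A ∈ ball (0 : Λ → 𝔄) r, ∀ c, ∑ b, ‖kD A c b‖ ≤ Dc * ‖A‖ := fun A hA c =>
    (rowSum_le_of_decay_torus (kD A) pos pos (mul_nonneg hc₀ (norm_nonneg A)) hδ hm (hkD A hA) c).trans
      (by nlinarith [mul_le_mul_of_nonneg_right hDc (norm_nonneg A)])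
  have hDcol : ∀ A ∈ ball (0 : Λ → 𝔄) r, ∀ b, ∑ c, ‖kD A c b‖ ≤ Dc * ‖A‖ := fun A hA b =>
    (colSum_le_of_decay_torus (kD A) pos pos (mul_nonneg hc₀ (norm_nonneg A)) hδ hm (hkD A hA) b).trans
      (by nlinarith [mul_le_mul_of_nonneg_right hDc (norm_nonneg A)])
  have hD₃col : ∀ A ∈ ball (0 : Λ → 𝔄) r, ∀ b, ∑ c, ‖kD₃ A c b‖ ≤ D₃c * ‖A‖ ^ 2 := fun A hA b =>
    (colSum_le_of_decay_torus (kD₃ A) pos pos (by positivity : 0 ≤ c₃ * ‖A‖ ^ 2) hδ hm (hkD₃ A hA) b).trans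
      (by nlinarith [mul_le_mul_of_nonneg_right hD₃c (sq_nonneg ‖A‖)])
  have hHrow : ∀ e, ∑ c, ‖hH e c‖ ≤ Hc := fun e => (rowSum_le_of_decay_torus hH pos pos hh₀ hδH hm hhH e).trans hHc
  have hHcol : ∀ c, ∑ e, ‖hH e c‖ ≤ Hc := fun c => (colSum_le_of_decay_torus hH pos pos hh₀ hδH hm hhH c).trans hHc
  have hProw : ∀ e, ∑ c, ‖hP e c‖ ≤ Pc := fun e => (rowSum_le_of_decay_torus hP pos pos hp₀ hδP hm hhP e).trans hPc
  have hPcol : ∀ c, ∑ e, ‖hP e c‖ ≤ Pc := fun c => (colSum_le_of_decay_torus hP pos pos hp₀ hδP hm hhP c).trans hPc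
  have hKrow : ∀ e, ∑ b, ‖compKer hP hH e b‖ ≤ Pc * Hc := rowSum_compKer_le hP hH hHc0 hProw hHrow
  have hKcol : ∀ b, ∑ e, ‖compKer hP hH e b‖ ≤ Pc * Hc := colSum_compKer_le hP hH hPc0 hPcol hHcol
  have hDd : DifferentiableOn ℂ D (ball 0 r) := hDa.differentiableOn
  have hD₃d : DifferentiableOn ℂ D₃ (ball 0 r) := hD₃a.differentiableOn
  refine prop4Hyp_locGrad_termsHD hr hr1 hrR₀ (mul_nonneg hHc0 hDc0) (mul_nonneg hHc0 hDc0)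
    (mul_nonneg (mul_nonneg hPc0 hHc0) hDc0) (mul_nonneg (mul_nonneg hPc0 hHc0) hDc0) (mul_nonneg hHc0 hD₃c0) hC₀
    hsmall hJ (analyticOnNhd_kerOp_comp hH hDa) (analyticOnNhd_kerOp_comp hH hD₃a)
    (analyticOnNhd_kerOp_comp (compKer hP hH) hDa) hV₀a
    (row_binder_kerOp_of_kernel hDc0 hDd hD0 kD hker hDrow hH hHc0 hHrow)
    (row_binder_kerOp_of_kernel hDc0 hDd hD0 kD hker hDrow (compKer hP hH) (mul_nonneg hPc0 hHc0) hKrow)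
    (fun A hA b X => ?_) (fun A hA b X => ?_) (fun A hA b X => ?_) hV₀g
  · have h := col_binder_kerOp_of_kernel hDd kD hker (fun A => Dc * ‖A‖) hDcol hH hHc0 hHcol A hA b X
    calc _ ≤ Hc * (Dc * ‖A‖) * ‖X‖ := h
      _ = Hc * Dc * ‖A‖ * ‖X‖ := by ring
  · have h := col_binder_kerOp_of_kernel hDd kD hker (fun A => Dc * ‖A‖) hDcol (compKer hP hH)
      (mul_nonneg hPc0 hHc0) hKcol A hA b X
    calc _ ≤ Pc * Hc * (Dc * ‖A‖) * ‖X‖ := h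
      _ = Pc * Hc * Dc * ‖A‖ * ‖X‖ := by ring
  · have h := col_binder_kerOp_of_kernel hD₃d kD₃ hker₃ (fun A => D₃c * ‖A‖ ^ 2) hD₃col hH hHc0 hHcol A hA b X
    calc _ ≤ Hc * (D₃c * ‖A‖ ^ 2) * ‖X‖ := h
      _ = Hc * D₃c * ‖A‖ ^ 2 * ‖X‖ := by ring

end Summit.QuantumFields.BalabanUV.T4Continuum.ShellMeasureDecayKernelBinders

end
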